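import Summits.ValiantsHypothesis.ValiantsHypothesis.Theorems.NNDivisionHard.Negative.RealLambdaLower
import Literature.Combinatorics.Optimization.UdisjShiftNonnegativeRank

/-!
# Real-λ visibility of the located permutahedron pencil, part 4 (§6): ★★★ THEOREM T3 — `rank₊ M_λ ≥ 2^{Ω(min(n, λ^{−1/2}))}`: the clique rows SEE `Q^Π_λ` once `λ·log² n → 0`

PORT NOTE (staged by the AUTHOR val-idea-39 g5 for the Negative-lane port pool; critic of record val-idea-crit-9 g3): texts VERBATIM BY NAME from the crux
workfile `Cruxes/NNDivisionHard/RealLambda39.lean` rev 5 @9c16232c0fed (sha16 ed657dc4b3d34535; farm rc 0 / 0 sorries / 0 warnings; axioms of `pencil_visible`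
= [propext, Classical.choice, Quot.sound]), memo `Cruxes/NNDivisionHard/RealLambda39.md` rev 4 @79cb6fe93e81 §2½.  Deltas vs the workfile: namespace
`…Theorems.NNDivisionHardNegative.RealLambda` (sibling of `…WeakReliefBlind`), this header; part 4 of the split (§1–§2 / §3+§5 / §4 / §6).  A CENSUS theorem
(nonnegative-rank LOWER bound for one explicit matrix family, from a print theorem already DISCHARGED in the tree); no item closes; VP ≠ VNP is NOT proved;
the crux `NNDivisionHard` (stmt-ValiantsHypothesis-21181) stays OPEN; nothing here bears on its status.

Two-column averaging on PAIRED rows: `â = {2i : i ∈ a} ∪ {2i+1 : i ∉ a}` (`a ⊆ [m]`, `2m ≤ n`), `b̂ = {2i : i ∈ b}`, `rev = (l ↦ 2m−1−l on [2m])`: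
`|â ∩ b̂| = |a ∩ b|` (`rowEmb_inter_colEmb_card`) and `inv(â; id) + inv(â; rev) = m²` for every `a` (`inv_pair_sum`, from the closed form `inv_closed` of
part 3), so `½·M_λ[â;(b̂,id)] + ½·M_λ[â;(b̂,rev)] = (1 − |a∩b|)² + λm²/2` is a `ρ`-extension of `UDISJ_m` (`ρ = 1 + λm²/2`) factorising through the SAME slots
as `M_λ`; Braun–Fiorini–Pokutta–Steurer 2012 Theorem 5 in the tree's explicit set form `Literature.Combinatorics.Optimization.udisjShift_nonnegRank_explicit`
(`e^{ℓ/(144ρ²)} ≤ 32 ℓ ρ |S|`, `4(ℓ−1)+3 ≤ m`) with `ρ ≤ 2` gives `pencil_visible : e^{(k+1)/576} ≤ 64(k+1)|S|` and the currency form `pencil_visible_rank`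
(`HasNonnegFactorization (pencil n λ) r → e^{(k+1)/576} ≤ 64(k+1)·r`).  With part 2's `hasNonnegFactorization_pencil_poly` (`rank₊ ≤ (n+1)^{4⌈2/λ⌉+1}`):
blind at every constant `λ`, visible once `λ·log² n → 0`; the S2 visibility threshold is a function `λ*(n) → 0` in the window `[c/log² n, O(1)]`.
[cite: BraunEtAl2012, Thm 5 (§3.2, pp. 11–12)]
-/

-- the mandated summit-side namespace repeats a component by design (single-problem summit)
set_option linter.dupNamespace false

namespace Summit.ValiantsHypothesis.Theorems.NNDivisionHardNegative.RealLambda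

open Finset
open Summit.ValiantsHypothesis.Theorems.NNDivisionHardNegative.WeakReliefBlind (inv)

noncomputable section

variable {n : ℕ}

/-! ## §6  VISIBLE at small `λ(n)` (memo T3): `rank₊ M_λ ≥ 2^{Ω(min(n, λ^{-1/2}))}` via Braun–Fiorini–Pokutta–Steurer 2012, Theorem 5

Average the two columns `(b̂, id)` and `(b̂, rev_{2m})` of `M_λ` on the PAIRED rows `â = {2i : i ∈ a} ∪ {2i+1 : i ∉ a}` (`a ⊆ [m]`, `2m ≤ n`;
`b̂ = {2i : i ∈ b}`): `|â ∩ b̂| = |a ∩ b|` and `inv(â; id) + inv(â; rev) = m²` for EVERY `a ⊆ [m]` (closed form `inv_closed`: each `l ∈ â` has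
`l + rev l = 2m − 1`), so the average is the `ρ`-extension `(1 − |a ∩ b|)² + λm²/2` of `UDISJ_m`, `ρ = 1 + λm²/2`; a nonnegative factorisation
of `M_λ` through `S` averages to one of it through the same `S`, and the tree's DISCHARGED BFPS Theorem 5
(`Literature.Combinatorics.Optimization.udisjShift_nonnegRank_explicit`: `e^{ℓ/(144ρ²)} ≤ 32 ℓ ρ |S|` for `4(ℓ−1)+3 ≤ m`) applies.  With
`λm² ≤ 2` (`ρ ≤ 2`): `|S| ≥ e^{ℓ/576}/(64 ℓ)`, `ℓ ≈ m/4`, `m ≈ min(n/2, √(2/λ))` — so `rank₊ M_λ^{(n)} ≥ 2^{Ω(min(n, λ^{−1/2}))}`: the clique rows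
SEE `Q^Π_λ` (superpolynomial nonnegative rank, by ANY certificate) as soon as `λ·log² n → 0`, while T1 makes them blind at every constant `λ`.
The visibility transition `λ*(n)` of S2 therefore EXISTS as a function tending to `0` and sits in `[c/log² n, O(1)]`. -/

section Visible

variable {m : ℕ}

/-- paired row embedding `â = {2i + [i ∉ a] : i < m} ⊆ [n]` (`2m ≤ n`) -/
def rowEmb (hmn : 2 * m ≤ n) (a : Finset (Fin m)) : Finset (Fin n) :=
  Finset.univ.image fun i : Fin m =>
    (⟨2 * (i : ℕ) + (if i ∈ a then 0 else 1), by have := i.2; split_ifs <;> omega⟩ : Fin n)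

/-- column embedding `b̂ = {2i : i ∈ b} ⊆ [n]` -/
def colEmb (hmn : 2 * m ≤ n) (b : Finset (Fin m)) : Finset (Fin n) :=
  b.image fun i : Fin m => (⟨2 * (i : ℕ), by have := i.2; omega⟩ : Fin n)

/-- block reversal `l ↦ 2m − 1 − l` on `l < 2m`, identity above -/
def revFun (hmn : 2 * m ≤ n) (l : Fin n) : Fin n :=
  if h : (l : ℕ) < 2 * m then ⟨2 * m - 1 - (l : ℕ), by omega⟩ else l

/-- Port helper `revFun_val` (statement and proof verbatim from the crux workfile; see the file header). -/
theorem revFun_val (hmn : 2 * m ≤ n) (l : Fin n) :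
    ((revFun hmn l : Fin n) : ℕ) = if (l : ℕ) < 2 * m then 2 * m - 1 - (l : ℕ) else (l : ℕ) := by
  unfold revFun
  split_ifs <;> rfl

/-- Port helper `revFun_involutive` (statement and proof verbatim from the crux workfile; see the file header). -/
theorem revFun_involutive (hmn : 2 * m ≤ n) : Function.Involutive (revFun (n := n) hmn) := by
  intro l
  apply Fin.ext
  rw [revFun_val, revFun_val]
  split_ifs <;> omega

/-- the block reversal as a permutation of `Fin n` -/
def revPerm (hmn : 2 * m ≤ n) : Equiv.Perm (Fin n) :=
  Function.Involutive.toPerm (revFun hmn) (revFun_involutive hmn)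

/-- Port helper `revPerm_val` (statement and proof verbatim from the crux workfile; see the file header). -/
theorem revPerm_val (hmn : 2 * m ≤ n) (l : Fin n) :
    ((revPerm hmn l : Fin n) : ℕ) = if (l : ℕ) < 2 * m then 2 * m - 1 - (l : ℕ) else (l : ℕ) := by
  unfold revPerm
  rw [Function.Involutive.coe_toPerm]
  exact revFun_val hmn l

/-- Port helper `mem_rowEmb` (statement and proof verbatim from the crux workfile; see the file header). -/
theorem mem_rowEmb (hmn : 2 * m ≤ n) (a : Finset (Fin m)) (l : Fin n) :
    l ∈ rowEmb hmn a ↔ ∃ i : Fin m, (l : ℕ) = 2 * (i : ℕ) + (if i ∈ a then 0 else 1) := by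
  unfold rowEmb
  rw [Finset.mem_image]
  constructor
  · rintro ⟨i, _, rfl⟩
    exact ⟨i, rfl⟩
  · rintro ⟨i, hi⟩
    exact ⟨i, Finset.mem_univ _, Fin.ext hi.symm⟩

/-- Port helper `lt_of_mem_rowEmb` (statement and proof verbatim from the crux workfile; see the file header). -/
theorem lt_of_mem_rowEmb (hmn : 2 * m ≤ n) (a : Finset (Fin m)) (l : Fin n) (hl : l ∈ rowEmb hmn a) :
    (l : ℕ) < 2 * m := by
  obtain ⟨i, hi⟩ := (mem_rowEmb hmn a l).1 hl
  have := i.2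
  split_ifs at hi <;> omega

/-- Port helper `rowEmb_card` (statement and proof verbatim from the crux workfile; see the file header). -/
theorem rowEmb_card (hmn : 2 * m ≤ n) (a : Finset (Fin m)) : (rowEmb hmn a).card = m := by
  unfold rowEmb
  rw [Finset.card_image_of_injective, Finset.card_univ, Fintype.card_fin]
  intro i j hij
  have h := congrArg (fun x : Fin n => (x : ℕ)) hij
  dsimp only at h
  apply Fin.ext
  split_ifs at h <;> omega

/-- Port helper `rowEmb_inter_colEmb` (statement and proof verbatim from the crux workfile; see the file header). -/
theorem rowEmb_inter_colEmb (hmn : 2 * m ≤ n) (a b : Finset (Fin m)) :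
    rowEmb hmn a ∩ colEmb hmn b = (a ∩ b).image fun i : Fin m => (⟨2 * (i : ℕ), by have := i.2; omega⟩ : Fin n) := by
  ext l
  rw [Finset.mem_inter, mem_rowEmb, Finset.mem_image]
  unfold colEmb
  rw [Finset.mem_image]
  constructor
  · rintro ⟨⟨i, hi⟩, ⟨j, hj, rfl⟩⟩
    dsimp only at hi
    by_cases hia : i ∈ a
    · rw [if_pos hia] at hi
      have hij : j = i := Fin.ext (by omega)
      subst hij
      exact ⟨j, Finset.mem_inter.2 ⟨hia, hj⟩, rfl⟩
    · rw [if_neg hia] at hi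
      omega
  · rintro ⟨i, hi, rfl⟩
    rw [Finset.mem_inter] at hi
    refine ⟨⟨i, ?_⟩, ⟨i, hi.2, rfl⟩⟩
    dsimp only
    rw [if_pos hi.1, Nat.add_zero]

/-- Port helper `rowEmb_inter_colEmb_card` (statement and proof verbatim from the crux workfile; see the file header). -/
theorem rowEmb_inter_colEmb_card (hmn : 2 * m ≤ n) (a b : Finset (Fin m)) :
    (rowEmb hmn a ∩ colEmb hmn b).card = (a ∩ b).card := by
  rw [rowEmb_inter_colEmb, Finset.card_image_of_injective]
  intro i j hij
  have h := congrArg (fun x : Fin n => (x : ℕ)) hij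
  dsimp only at h
  exact Fin.ext (by omega)

/-- `inv(â; id) + inv(â; rev) = m²` for every paired row. -/
theorem inv_pair_sum (hmn : 2 * m ≤ n) (a : Finset (Fin m)) :
    (inv (rowEmb hmn a) (1 : Equiv.Perm (Fin n)) : ℝ) + (inv (rowEmb hmn a) (revPerm hmn) : ℝ) = (m : ℝ) ^ 2 := by
  rw [inv_closed, inv_closed, rowEmb_card]
  have h : ∑ l, X (rowEmb hmn a) l * ((((1 : Equiv.Perm (Fin n)) l : Fin n) : ℕ) : ℝ)
      + ∑ l, X (rowEmb hmn a) l * (((revPerm hmn l : Fin n) : ℕ) : ℝ) = (2 * (m : ℝ) - 1) * m := by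
    rw [← Finset.sum_add_distrib]
    have : ∀ l, X (rowEmb hmn a) l * ((((1 : Equiv.Perm (Fin n)) l : Fin n) : ℕ) : ℝ)
        + X (rowEmb hmn a) l * (((revPerm hmn l : Fin n) : ℕ) : ℝ) = X (rowEmb hmn a) l * (2 * (m : ℝ) - 1) := by
      intro l
      by_cases hl : l ∈ rowEmb hmn a
      · have hlt := lt_of_mem_rowEmb hmn a l hl
        have hr : ((revPerm hmn l : Fin n) : ℕ) = 2 * m - 1 - (l : ℕ) := by rw [revPerm_val, if_pos hlt]
        rw [Equiv.Perm.coe_one, id, hr, ← mul_add]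
        congr 1
        have h1 : (l : ℕ) + (2 * m - 1 - (l : ℕ)) = 2 * m - 1 := by omega
        have h2 : (((l : ℕ) : ℝ) + ((2 * m - 1 - (l : ℕ) : ℕ) : ℝ)) = ((2 * m - 1 : ℕ) : ℝ) := by exact_mod_cast h1
        rw [h2]
        have h3 : 1 ≤ 2 * m := by omega
        push_cast [h3]
        ring
      · simp [X, hl]
    rw [Finset.sum_congr rfl fun l _ => this l, ← Finset.sum_mul, sum_X_univ, rowEmb_card]
    ring
  linear_combination h

open Literature.Combinatorics.Optimization (HasNonnegFactorization udisjShift_nonnegRank_explicit)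

/-- ★★★ **THEOREM T3 (kernel): the located permutahedron pencil is clique-VISIBLE at small `λ(n)`.**  If `2m ≤ n`, `4k + 3 ≤ m`,
`0 ≤ λ` and `λ·m² ≤ 2`, then every nonnegative factorisation of `M_λ^{(n)} = pencil n λ` through a finite slot type `S` has
`e^{(k+1)/576} ≤ 64 (k+1) |S|`.  (Take `m = min(⌊n/2⌋, ⌊√(2/λ)⌋)`, `k = ⌊(m−3)/4⌋`: `rank₊ M_λ ≥ 2^{Ω(min(n, λ^{−1/2}))}`; superpolynomial in
`n` as soon as `λ·log² n → 0`.)  Proof: two-column average on paired rows = `ρ`-extension of `UDISJ_m` with `ρ = 1 + λm²/2 ≤ 2`, then the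
tree's discharged BFPS 2012 Theorem 5 `udisjShift_nonnegRank_explicit`. [cite: BraunEtAl2012, Thm 5 (§3.2, pp. 11–12)] -/
theorem pencil_visible {k : ℕ} (hmn : 2 * m ≤ n) (hk : 4 * k + 3 ≤ m) (lam : ℝ) (hlam : 0 ≤ lam)
    (hsmall : lam * (m : ℝ) ^ 2 ≤ 2) {S : Type*} [Fintype S]
    (U : Finset (Fin n) → S → ℝ) (V : Finset (Fin n) × Equiv.Perm (Fin n) → S → ℝ)
    (hU : ∀ a s, 0 ≤ U a s) (hV : ∀ bπ s, 0 ≤ V bπ s) (hfac : ∀ a bπ, pencil n lam a bπ = ∑ s, U a s * V bπ s) :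
    Real.exp ((k + 1 : ℝ) / 576) ≤ 64 * (k + 1) * Fintype.card S := by
  classical
  set ρ : ℝ := 1 + lam * (m : ℝ) ^ 2 / 2 with hρ
  have hρ1 : 1 ≤ ρ := by rw [hρ]; nlinarith
  have hρ2 : ρ ≤ 2 := by rw [hρ]; linarith
  have hkm : 4 * k + 3 ≤ Fintype.card (Fin m) := by rwa [Fintype.card_fin]
  -- the averaged matrix on `Finset (Fin m)`
  have key := udisjShift_nonnegRank_explicit (α := Fin m) hkm hρ1
    (fun a b => ((1 : ℝ) - ((a ∩ b).card : ℝ)) ^ 2 + lam * (m : ℝ) ^ 2 / 2)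
    (fun a b hab => by
      rw [Finset.disjoint_iff_inter_eq_empty.1 hab, Finset.card_empty, hρ]; push_cast; ring)
    (fun a b hab => by rw [hab, hρ]; push_cast; ring)
    (fun a s => U (rowEmb hmn a) s)
    (fun b s => (V (colEmb hmn b, 1) s + V (colEmb hmn b, revPerm hmn) s) / 2)
    (fun a s => hU _ _) (fun b s => by have := hV (colEmb hmn b, 1) s; have := hV (colEmb hmn b, revPerm hmn) s; linarith)
    (fun a b => by
      have h1 := hfac (rowEmb hmn a) (colEmb hmn b, 1)
      have h2 := hfac (rowEmb hmn a) (colEmb hmn b, revPerm hmn)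
      unfold pencil at h1 h2
      dsimp only at h1 h2
      rw [rowEmb_inter_colEmb_card] at h1 h2
      have hs := inv_pair_sum hmn a
      have : ∑ s, U (rowEmb hmn a) s * ((V (colEmb hmn b, 1) s + V (colEmb hmn b, revPerm hmn) s) / 2)
          = (∑ s, U (rowEmb hmn a) s * V (colEmb hmn b, 1) s + ∑ s, U (rowEmb hmn a) s * V (colEmb hmn b, revPerm hmn) s) / 2 := by
        rw [← Finset.sum_add_distrib, Finset.sum_div]
        refine Finset.sum_congr rfl fun s _ => ?_
        ring
      rw [this, ← h1, ← h2]
      linear_combination (-lam / 2) * hs)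
  -- weaken `ρ` to `2`
  have hexp : Real.exp ((k + 1 : ℝ) / 576) ≤ Real.exp ((k + 1 : ℝ) / (144 * ρ ^ 2)) := by
    apply Real.exp_le_exp.2
    have h144 : 144 * ρ ^ 2 ≤ 576 := by nlinarith
    exact div_le_div_of_nonneg_left (by positivity) (by positivity) h144
  have hS0 : (0 : ℝ) ≤ Fintype.card S := by positivity
  calc Real.exp ((k + 1 : ℝ) / 576) ≤ Real.exp ((k + 1 : ℝ) / (144 * ρ ^ 2)) := hexp
    _ ≤ 32 * (k + 1) * ρ * Fintype.card S := key
    _ ≤ 32 * (k + 1) * 2 * Fintype.card S := by gcongr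
    _ = 64 * (k + 1) * Fintype.card S := by ring

/-- T3 in the tree's currency: `HasNonnegFactorization (pencil n λ) r → e^{(k+1)/576} ≤ 64(k+1)·r` under the same side conditions —
with T1 (`hasNonnegFactorization_pencil_poly`) the nonnegative rank of `M_λ^{(n)}` is `n^{O(1/λ)}` and `2^{Ω(min(n, λ^{−1/2}))}`. -/
theorem pencil_visible_rank {k : ℕ} (hmn : 2 * m ≤ n) (hk : 4 * k + 3 ≤ m) (lam : ℝ) (hlam : 0 ≤ lam)
    (hsmall : lam * (m : ℝ) ^ 2 ≤ 2) {r : ℕ} (h : HasNonnegFactorization (pencil n lam) r) :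
    Real.exp ((k + 1 : ℝ) / 576) ≤ 64 * (k + 1) * r := by
  obtain ⟨U, V, hU, hV, hM⟩ := h
  have := pencil_visible hmn hk lam hlam hsmall U (fun bπ s => V s bπ) hU (fun bπ s => hV s bπ) hM
  simpa using this

end Visible

end

end Summit.ValiantsHypothesis.Theorems.NNDivisionHardNegative.RealLambda
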